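import Literature.NumberTheory.Automorphic.NewformAdelisationArchCovariance
import Literature.NumberTheory.Automorphic.GL2ZFiniteOfEigenfunction
import HarnessLib

/-!
# The adelic lift of a modular form is `K_∞`-finite (Borel–Jacquet 4.2 (b) for `φ_f`)

Topic `NumberTheory/Automorphic`; theorems only (no definition, no named fact; D-0026). Brick of the
dictionary `f ↦ π_f` (Gelbart 1975, §3, Prop. 3.1 (iii); Gelbart 1997, (2.5.4) (iii); Bump 1997,
§3.2, §3.6): the right translates of the adelic lift `φ_f = adelicLiftFunA N k f` of a form of
weight `k` by the maximal compact subgroup `K_∞ = O(2)` of the archimedean group of the `GL₂/ℚ`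
automorphy datum span the (at most) two-dimensional space `ℂ φ_f + ℂ r(ε) φ_f`:

* `exists_rotGL_of_transpose_mul_self` — **`O(2) = SO(2) ⊔ SO(2) ε`**: a real `2 × 2` matrix with
  `Mᵀ M = 1` is `r(θ)` or `r(θ) ε` (`ε = diag(1, -1)`);
* `Rat.exists_realToMixedGL_eq` — `GL₂(ℝ) → GL₂(ℚ_∞)` is onto (`ℝ ≃ ℚ_∞ = mixedSpace ℚ`,
  `Rat.bijective_algebraMap_mixedSpace`);
* `Rat.transpose_mul_self_of_realToMixedGL_mem_maximalCompact` — an element of `K_∞` comes from an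
  orthogonal real matrix;
* `kTranslateSpan_adelicLiftFunA_le` — `⟨r(k) φ_f : k ∈ K_∞⟩ ≤ ℂ φ_f + ℂ r(ε) φ_f`
  (`r(k_θ) φ_f = e^{ikθ} φ_f`, `r(k_θ) r(ε) φ_f = e^{-ikθ} r(ε) φ_f`: `isWeightVec_adelicLiftFunA`,
  `IsWeightVec.archTranslate_rotK`, `IsWeightVec.archTranslate_epsK`);
* `isKFinite_adelicLiftFunA` — **`φ_f` is `K_∞`-finite** (`IsKFinite (AutomorphyDatum.gl 2 ℚ hcpt).ofArch`).

## References

* A. Borel, H. Jacquet, *Automorphic forms and automorphic representations*, Corvallis 1979, §1.3,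
  4.2 (b). [BorelJacquet1979]
* S. Gelbart, *Automorphic forms on adele groups* (1975), Prop. 3.1 (iii). [Gelbart1975]
* D. Bump, *Automorphic Forms and Representations* (1997), §3.2, §3.6. [Bump1997]
-/

noncomputable section

open scoped MatrixGroups Matrix Classical
open NumberField NumberField.mixedEmbedding

namespace Literature.NumberTheory.Automorphic

-- Mathlib idiom (Mathlib/Algebra/Lie/OfAssociative.lean), as in `GL2WeightVectors`: Lie subalgebras of matrix algebras.
attribute [local instance 100] LieRing.ofAssociativeRing

open GL2Real

/-! ### `O(2) = SO(2) ⊔ SO(2) ε` -/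

section OrthogonalTwo

/-- **`O(2) = SO(2) ⊔ SO(2)ε`.** A real `2 × 2` matrix `M` with `Mᵀ M = 1` is a rotation `r(θ)`
or `r(θ) ε`, `ε = diag(1, -1)`: its first column is a unit vector `(cos θ, sin θ)`, the second is
`± (-sin θ, cos θ)` with the sign `det M = ±1`. [folklore] -/
theorem exists_rotGL_of_transpose_mul_self (M : GL (Fin 2) ℝ)
    (h : ((M : Matrix (Fin 2) (Fin 2) ℝ))ᵀ * (M : Matrix (Fin 2) (Fin 2) ℝ) = 1) :
    ∃ θ : ℝ, M = rotGL θ ∨ M = rotGL θ * epsGL := by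
  obtain ⟨a, b, c, d, hM⟩ : ∃ a b c d : ℝ, (M : Matrix (Fin 2) (Fin 2) ℝ) = !![a, b; c, d] :=
    ⟨_, _, _, _, Matrix.eta_fin_two _⟩
  rw [hM] at h
  have h00 := congrFun (congrFun h 0) 0
  have h01 := congrFun (congrFun h 0) 1
  have h11 := congrFun (congrFun h 1) 1
  simp [Matrix.mul_apply, Matrix.transpose_apply, Fin.sum_univ_two] at h00 h01 h11
  -- `h00 : a * a + c * c = 1`, `h01 : a * b + c * d = 0`, `h11 : b * b + d * d = 1`
  -- the sign `λ = det M = ±1`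
  have hl2 : (a * d - b * c) * (a * d - b * c) = 1 := by
    have := congrArg Matrix.det h
    rwa [Matrix.det_mul, Matrix.det_transpose, Matrix.det_one, Matrix.det_fin_two_of] at this
  have hd' : d = (a * d - b * c) * a := by linear_combination c * h01 - d * h00
  have hb' : b = -((a * d - b * c) * c) := by linear_combination a * h01 - b * h00
  -- the angle
  have hzn : ‖(⟨a, c⟩ : ℂ)‖ = 1 := by
    have h2 : ‖(⟨a, c⟩ : ℂ)‖ ^ 2 = 1 := by
      rw [Complex.sq_norm, Complex.normSq_apply]
      simpa using h00
    nlinarith [h2, norm_nonneg (⟨a, c⟩ : ℂ)]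
  have hz0 : (⟨a, c⟩ : ℂ) ≠ 0 := by
    intro h0; rw [h0, norm_zero] at hzn; exact zero_ne_one hzn
  have hcos : Real.cos (Complex.arg ⟨a, c⟩) = a := by
    rw [Complex.cos_arg hz0, hzn, div_one]
  have hsin : Real.sin (Complex.arg ⟨a, c⟩) = c := by
    rw [Complex.sin_arg, hzn, div_one]
  refine ⟨Complex.arg ⟨a, c⟩, ?_⟩
  rcases mul_self_eq_one_iff.mp hl2 with h1 | h1
  · left
    refine Units.ext ?_
    rw [hM, coe_rotGL, hcos, hsin]
    rw [h1] at hb' hd'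
    ext i j
    fin_cases i <;> fin_cases j <;> simp [hb', hd']
  · right
    refine Units.ext ?_
    rw [Units.val_mul, hM, coe_rotGL, coe_epsGL, hcos, hsin]
    rw [h1] at hb' hd'
    ext i j
    fin_cases i <;> fin_cases j <;> simp [Matrix.mul_apply, Fin.sum_univ_two, hb', hd']

end OrthogonalTwo

/-! ### `K_∞` of the `GL₂/ℚ` datum comes from `O(2)` -/

section KInfinity

variable {hcpt : isCompact_glFiniteIntegralLevel 2 ℚ}

/-- **`GL₂(ℝ) → GL₂(ℚ_∞)` is onto** (`ℝ ≃ ℚ_∞ = mixedSpace ℚ`, `Rat.bijective_algebraMap_mixedSpace`). [folklore] -/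
theorem Rat.exists_realToMixedGL_eq (κ : GL (Fin 2) (mixedSpace ℚ)) :
    ∃ M : GL (Fin 2) ℝ, Rat.realToMixedGL 2 M = κ := by
  let e : ℝ ≃ₐ[ℝ] mixedSpace ℚ :=
    AlgEquiv.ofBijective (Algebra.ofId ℝ (mixedSpace ℚ)) Rat.bijective_algebraMap_mixedSpace
  refine ⟨Matrix.GeneralLinearGroup.map (e.symm : mixedSpace ℚ →+* ℝ) κ, ?_⟩
  refine Units.ext (Matrix.ext fun i j => ?_)
  change algebraMap ℝ (mixedSpace ℚ) (e.symm ((κ : Matrix (Fin 2) (Fin 2) (mixedSpace ℚ)) i j)) = _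
  exact e.apply_symm_apply _

/-- `star (M ⊗ 1) = Mᵀ ⊗ 1` in `M₂(ℚ_∞)` for a real matrix `M` (`ℚ` has no complex place). [folklore] -/
theorem Rat.star_coe_realToMixedGL (g : GL (Fin 2) ℝ) :
    star ((Rat.realToMixedGL 2 g : GL (Fin 2) (mixedSpace ℚ)) : Matrix (Fin 2) (Fin 2) (mixedSpace ℚ)) =
      ((g : Matrix (Fin 2) (Fin 2) ℝ)ᵀ).map (algebraMap ℝ (mixedSpace ℚ)) := by
  ext i j
  · simp [Matrix.star_apply, Matrix.map_apply, Matrix.transpose_apply, Rat.realToMixedGL, Prod.algebraMap_apply,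
      Pi.algebraMap_apply]
  · rename_i x
    exact absurd x.2 (NumberField.InfinitePlace.not_isComplex_iff_isReal.2
      (by rw [Subsingleton.elim x.1 Rat.infinitePlace]; exact Rat.isReal_infinitePlace))

/-- **An element of `K_∞` comes from an orthogonal real matrix**: if `M ⊗ 1 ∈ K_∞` (the maximal
compact = unitary subgroup of `GL₂(ℚ_∞)`), then `Mᵀ M = 1`. [folklore] -/
theorem Rat.transpose_mul_self_of_realToMixedGL_mem_maximalCompact {M : GL (Fin 2) ℝ}
    (h : Rat.realToMixedGL 2 M ∈ (AutomorphyDatum.gl 2 ℚ hcpt).arch.maximalCompact) :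
    ((M : Matrix (Fin 2) (Fin 2) ℝ))ᵀ * (M : Matrix (Fin 2) (Fin 2) ℝ) = 1 := by
  have h1 := ((RealMatrixGroup.mem_maximalCompact_iff _ _).1 h).2
  rw [Rat.star_coe_realToMixedGL] at h1
  change ((M : Matrix (Fin 2) (Fin 2) ℝ)ᵀ).map (algebraMap ℝ (mixedSpace ℚ)) *
      (M : Matrix (Fin 2) (Fin 2) ℝ).map (algebraMap ℝ (mixedSpace ℚ)) = 1 at h1
  rw [← Matrix.map_mul, ← Matrix.map_one (algebraMap ℝ (mixedSpace ℚ)) (map_zero _) (map_one _)] at h1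
  exact Matrix.map_injective Rat.bijective_algebraMap_mixedSpace.1 h1

end KInfinity

/-! ### `K_∞`-finiteness of the adelic lift -/

section Lift

variable {N : ℕ} [NeZero N] {k : ℤ} {F : Type*} [FunLike F UpperHalfPlane ℂ]
  [SlashInvariantFormClass F (CongruenceSubgroup.Gamma1 N) k] (f : F)
  {hcpt : isCompact_glFiniteIntegralLevel 2 ℚ}

/-- **The `K_∞`-translates of `φ_f` lie in `ℂ φ_f + ℂ r(ε) φ_f`.** For `k ∈ K_∞ = O(2)`:
`k = k_θ` gives `r(k) φ_f = e^{ikθ} φ_f`, and `k = k_θ ε` gives `r(k) φ_f = e^{-ikθ} r(ε) φ_f`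
(`isWeightVec_adelicLiftFunA`, `IsWeightVec.archTranslate_rotK`, `IsWeightVec.archTranslate_epsK`,
`Rat.archTranslate_iotaA_eq_rightTranslation_ofK`). Gelbart 1975, Prop. 3.1 (iii); Bump 1997, §3.2.
[cite: Gelbart1975, Prop. 3.1] [cite: BorelJacquet1979, §1.3] -/
theorem kTranslateSpan_adelicLiftFunA_le :
    kTranslateSpan (AutomorphyDatum.gl 2 ℚ hcpt).ofArch (adelicLiftFunA N k f) ≤
      Submodule.span ℂ {adelicLiftFunA N k f, archTranslate Rat.iotaA epsK (adelicLiftFunA N k f)} := by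
  refine Submodule.span_le.mpr ?_
  rintro _ ⟨κ, rfl⟩
  obtain ⟨M, hM⟩ := Rat.exists_realToMixedGL_eq ((κ : (AutomorphyDatum.gl 2 ℚ hcpt).arch.maximalCompact) :
    GL (Fin 2) (mixedSpace ℚ))
  have hmem : Rat.realToMixedGL 2 M ∈ (AutomorphyDatum.gl 2 ℚ hcpt).arch.maximalCompact := by rw [hM]; exact κ.2
  have hMt : ((M : Matrix (Fin 2) (Fin 2) ℝ))ᵀ * (M : Matrix (Fin 2) (Fin 2) ℝ) = 1 :=
    Rat.transpose_mul_self_of_realToMixedGL_mem_maximalCompact hmem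
  have hw : IsWeightVec Rat.iotaA k (adelicLiftFunA N k f) := isWeightVec_adelicLiftFunA f
  have hκ : κ = ⟨Rat.realToMixedGL 2 M, Rat.realToMixedGL_mem_maximalCompact hMt⟩ := Subtype.ext hM.symm
  have hk : archTranslate (AutomorphyDatum.gl 2 ℚ hcpt).ofArch
      (Subgroup.inclusion (AutomorphyDatum.gl 2 ℚ hcpt).arch.maximalCompact_le_carrier κ) (adelicLiftFunA N k f) =
      archTranslate Rat.iotaA (⟨M, Subgroup.mem_top _⟩ : (RealMatrixGroup.gl ℝ (Fin 2)).carrier) (adelicLiftFunA N k f) := by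
    rw [Rat.archTranslate_iotaA_eq_rightTranslation_ofK ⟨M, Subgroup.mem_top _⟩ hMt, AutomorphyDatum.archTranslate_ofK, hκ]
  change archTranslate (AutomorphyDatum.gl 2 ℚ hcpt).ofArch
      (Subgroup.inclusion (AutomorphyDatum.gl 2 ℚ hcpt).arch.maximalCompact_le_carrier κ) (adelicLiftFunA N k f) ∈ _
  rw [hk]
  obtain ⟨θ, hθ | hθ⟩ := exists_rotGL_of_transpose_mul_self M hMt
  · have e : (⟨M, Subgroup.mem_top _⟩ : (RealMatrixGroup.gl ℝ (Fin 2)).carrier) = rotK (-θ) :=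
      Subtype.ext (by rw [coe_rotK, neg_neg]; exact hθ)
    rw [e, hw.archTranslate_rotK]
    exact Submodule.smul_mem _ _ (Submodule.subset_span (Set.mem_insert _ _))
  · have e : (⟨M, Subgroup.mem_top _⟩ : (RealMatrixGroup.gl ℝ (Fin 2)).carrier) = rotK (-θ) * epsK :=
      Subtype.ext (by rw [Subgroup.coe_mul, coe_rotK, neg_neg, coe_epsK]; exact hθ)
    rw [e, map_mul, Module.End.mul_apply, (hw.archTranslate_epsK).archTranslate_rotK]
    exact Submodule.smul_mem _ _ (Submodule.subset_span (Set.mem_insert_of_mem _ (Set.mem_singleton _)))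

/-- **The adelic lift of a form of weight `k` is `K_∞`-finite** — property (b) of an automorphic
form (Borel–Jacquet 1979, 4.2) for `φ_f` and the `GL₂/ℚ` automorphy datum: the `K_∞`-translates
span a space of dimension `≤ 2`. [cite: BorelJacquet1979, 4.2 (b)] [cite: Gelbart1975, Prop. 3.1] -/
theorem isKFinite_adelicLiftFunA : IsKFinite (AutomorphyDatum.gl 2 ℚ hcpt).ofArch (adelicLiftFunA N k f) := by
  unfold IsKFinite
  haveI : FiniteDimensional ℂ
      (Submodule.span ℂ ({adelicLiftFunA N k f, archTranslate Rat.iotaA epsK (adelicLiftFunA N k f)} :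
        Set ((AdelicGroupData.gl 2 ℚ).Adelic → ℂ))) :=
    FiniteDimensional.span_of_finite ℂ (Set.toFinite _)
  exact Submodule.finiteDimensional_of_le (kTranslateSpan_adelicLiftFunA_le f)

end Lift

end Literature.NumberTheory.Automorphic
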